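import Mathlib
import HarnessLib
import Summits.Ventures.LatticeQCDFlow.Scoring.BatchMeansConsistency
import Summits.Ventures.LatticeQCDFlow.Scoring.MarkovChainSLLN

/-!
# THE BATCH-MEANS ESTIMATE OF THE INTEGRATED AUTOCORRELATION TIME IS CONSISTENT:
# `τ̂_N = (ab · SE²_BM) / (2 v̂_N) → τ_int` in probability, from any start, for every Doeblin kernel

HONEST FRAMING: exact (Metropolis-corrected) sampling algorithms for lattice gauge theory;
figures of merit are autocorrelation/cost numbers at stated couplings and volumes; no
continuum-physics claim.

Venture `LatticeQCDFlow` (cell pub-lqcd), topic `Scoring`; FANOUT row 8 (`s0-cpn-nemc`, GEN-19).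
NEW WORK of the cell, not a published result; no definition is introduced.  The cell's figure of
merit is `τ_int` per cost; a run reports it as `τ̂ = σ̂² / (2 v̂)` with `σ̂²` an estimate of the
Green–Kubo variance `σ²_f` and `v̂` the sample variance of the observable.  With `σ̂² = ab · SE²_BM` the
batch-means estimate (`Scoring/BatchMeansConsistency.lean`: `→ σ²_f` in probability from ANY start,
for every kernel `κ(x, ·) ≥ ε ν`, `0 < ε < 1`) and `v̂_N = (1/N) Σ_{t<N} f(X_t)² − ((1/N) Σ_{t<N} f(X_t))²`
(`→ Var_π f` almost surely from any start by GEN-18's `Scoring/MarkovChainSLLN.markovChain_slln`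
applied to `f` and `f²`), the ratio converges in probability to
`σ²_f / (2 Var_π f) = τ_int(ρ_f) = 1/2 + Σ_{t≥1} ρ_f(t)` (`Scoring/CalibrationTruths.tauInt` with the TRUE
autocorrelation function `ρ_f = γ/γ₀`) whenever `Var_π f ≠ 0`.  The one general-measure-theory step
is a continuous-mapping lemma for convergence in measure of a RATIO with a nonzero constant
denominator limit, proved from Mathlib's subsequence characterisation
(`exists_seq_tendstoInMeasure_atTop_iff`).  Nothing is cited.

## Content

* `tendstoInMeasure_div_const_limits` — `X_n → x`, `Y_n → y ≠ 0` in measure (finite measure, real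
  values, a.e.-strongly measurable) ⇒ `X_n / Y_n → x / y` in measure;
* `chain_sampleVariance_ae_tendsto` — `v̂_n → Var_π f = ∫ f̄² dπ` a.s. from any start;
* `two_mul_mul_tauInt_eq` — `2 γ₀ · tauInt (γ/γ₀) = γ₀ + 2 Σ' γ_{t+1}` (`γ₀ ≠ 0`);
* **`chain_batchMeans_tauInt_tendstoInMeasure`** — for `a_n, b_n → ∞`, `N_n = b_n a_n`, `Var_π f ≠ 0`:
  `TendstoInMeasure P_{μ₀} (fun n x => σ̂²_n(x) / (2 v̂_{N_n}(x))) atTop (fun _ => tauInt ρ_f)`.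

NOT CLAIMED: a rate; the windowing rules of the Γ-method; unbounded observables.
-/

noncomputable section

namespace Summit.Ventures.LatticeQCDFlow.Scoring

open MeasureTheory ProbabilityTheory Filter Finset Preorder Literature.Probability.MarkovChains
open scoped ENNReal Topology

/-! ### Convergence in measure of a ratio -/

section Ratio

variable {α : Type*} [MeasurableSpace α] {μ : Measure α} [IsFiniteMeasure μ]

/-- **Continuous mapping for a ratio, in measure**: if `X_n → x` and `Y_n → y` in measure with
`y ≠ 0` (real-valued, a.e.-strongly measurable, finite measure) then `X_n / Y_n → x / y` in measure. -/
theorem tendstoInMeasure_div_const_limits {X Y : ℕ → α → ℝ} {x y : ℝ}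
    (hXm : ∀ n, AEStronglyMeasurable (X n) μ) (hYm : ∀ n, AEStronglyMeasurable (Y n) μ)
    (hX : TendstoInMeasure μ X atTop (fun _ => x)) (hY : TendstoInMeasure μ Y atTop (fun _ => y))
    (hy : y ≠ 0) :
    TendstoInMeasure μ (fun n ω => X n ω / Y n ω) atTop (fun _ => x / y) := by
  have hm : ∀ n, AEStronglyMeasurable (fun ω => X n ω / Y n ω) μ := fun n =>
    ((hXm n).aemeasurable.div (hYm n).aemeasurable).aestronglyMeasurable
  refine (exists_seq_tendstoInMeasure_atTop_iff hm).2 fun ns hns => ?_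
  -- a subsequence along which `X` converges a.e.
  obtain ⟨ns₁, hns₁, h1⟩ := (exists_seq_tendstoInMeasure_atTop_iff hXm).1 hX ns hns
  -- a further subsequence along which `Y` converges a.e.
  have hY' : TendstoInMeasure μ (fun n => Y (ns (ns₁ n))) atTop (fun _ => y) :=
    hY.comp ((hns.comp hns₁).tendsto_atTop)
  obtain ⟨ns₂, hns₂, h2⟩ := hY'.exists_seq_tendsto_ae
  refine ⟨ns₁ ∘ ns₂, hns₁.comp hns₂, ?_⟩
  filter_upwards [h1, h2] with ω hω1 hω2
  exact (hω1.comp hns₂.tendsto_atTop).div hω2 hy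

end Ratio

/-! ### The sample variance and the batch-means `τ_int` -/

section TauInt

variable {Ω : Type*} [MeasurableSpace Ω]
  {κ : Kernel Ω Ω} [IsMarkovKernel κ] {ν : Measure Ω} [IsProbabilityMeasure ν] {ε : ℝ≥0∞}
  {π : Measure Ω} [IsProbabilityMeasure π]

/-- **The sample variance is strongly consistent from any start**:
`(1/n) Σ_{t<n} f(X_t)² − ((1/n) Σ_{t<n} f(X_t))² → ∫ f² dπ − (∫ f dπ)² = ∫ (f − π f)² dπ` a.s. -/
theorem chain_sampleVariance_ae_tendsto (hπ : Kernel.Invariant κ π)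
    (hmin : ∀ x {B : Set Ω}, MeasurableSet B → ε * ν B ≤ κ x B) (hε0 : 0 < ε) (hε : ε < 1)
    {f : Ω → ℝ} (hf : Measurable f) {C : ℝ} (hC : ∀ x, |f x| ≤ C)
    (μ₀ : Measure Ω) [IsProbabilityMeasure μ₀] :
    ∀ᵐ y ∂(Kernel.trajMeasure (X := fun _ : ℕ => Ω) μ₀
        (fun n : ℕ => κ.comap (fun h : (i : ↥(Finset.Iic n)) → Ω => h ⟨n, Finset.mem_Iic.2 le_rfl⟩)
          (measurable_pi_apply _))),
      Tendsto (fun n : ℕ => (∑ t ∈ Finset.range n, f (y t) ^ 2) / n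
        - ((∑ t ∈ Finset.range n, f (y t)) / n) ^ 2) atTop (𝓝 (∫ z, (f z - ∫ z', f z' ∂π) ^ 2 ∂π)) := by
  have hf2 : Measurable fun z => f z ^ 2 := hf.pow_const 2
  have hC0 : ∀ z, |f z ^ 2| ≤ C ^ 2 := fun z => by
    rw [abs_pow]; exact pow_le_pow_left₀ (abs_nonneg _) (hC z) 2
  have h1 := markovChain_slln (κ := κ) (ν := ν) hπ hmin hε0 hε hf hC μ₀
  have h2 := markovChain_slln (κ := κ) (ν := ν) hπ hmin hε0 hε hf2 hC0 μ₀
  -- the limit: `∫ f² − (∫ f)² = ∫ (f − ∫ f)²`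
  have hvar' : ∫ z, (f z - ∫ z', f z' ∂π) ^ 2 ∂π = ∫ z, f z ^ 2 ∂π - (∫ z, f z ∂π) ^ 2 := by
    have hi1 : Integrable f π := integrable_of_bounded π hf hC
    have hi2 : Integrable (fun z => f z ^ 2) π := integrable_of_bounded π hf2 hC0
    have hpt : ∀ z, (f z - ∫ z', f z' ∂π) ^ 2
        = f z ^ 2 - (2 * ∫ z', f z' ∂π) * f z + (∫ z', f z' ∂π) ^ 2 := fun z => by ring
    have hi3 : Integrable (fun z => f z ^ 2 - (2 * ∫ z', f z' ∂π) * f z) π := hi2.sub (hi1.const_mul _)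
    rw [integral_congr_ae (ae_of_all _ hpt), integral_add hi3 (integrable_const _),
      integral_sub hi2 (hi1.const_mul _), integral_const_mul, integral_const, probReal_univ, one_smul]
    ring
  rw [hvar']
  filter_upwards [h1, h2] with y hy1 hy2
  exact hy2.sub (hy1.pow 2)

omit [MeasurableSpace Ω] in
/-- `2 γ₀ · tauInt (γ/γ₀) = γ₀ + 2 Σ' γ_{t+1}` for `γ₀ ≠ 0` (Mathlib's `tsum` convention makes the
identity unconditional; it is used with a summable tail). -/
theorem two_mul_mul_tauInt_eq {γ : ℕ → ℝ} (h0 : γ 0 ≠ 0) :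
    2 * γ 0 * tauInt (fun t => γ t / γ 0) = γ 0 + 2 * ∑' t, γ (t + 1) := by
  unfold tauInt
  have htsum : ∑' t, γ (t + 1) / γ 0 = (∑' t, γ (t + 1)) / γ 0 := by
    rw [tsum_div_const]
  rw [htsum]
  field_simp

/-- **THE BATCH-MEANS `τ_int` IS CONSISTENT, FROM ANY START.**  `π` invariant, `κ(x, ·) ≥ ε ν`
(`0 < ε < 1`), `|f| ≤ C` measurable with `Var_π f ≠ 0`; `a_n, b_n → ∞`, `N_n = b_n a_n`;
`σ̂²_n = a_n b_n · SE²_BM`, `v̂_n` the sample variance of `f(X_0), …, f(X_{N_n − 1})`.  Then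
`σ̂²_n / (2 v̂_n) → tauInt(γ/γ₀) = 1/2 + Σ_{t≥1} γ_t/γ₀` in probability under `P_{μ₀}`, for EVERY initial
law `μ₀` (`γ_t = autocov κ π f̄ t`). -/
theorem chain_batchMeans_tauInt_tendstoInMeasure (hπ : Kernel.Invariant κ π)
    (hmin : ∀ x {B : Set Ω}, MeasurableSet B → ε * ν B ≤ κ x B) (hε0 : 0 < ε) (hε : ε < 1)
    {f : Ω → ℝ} (hf : Measurable f) {C : ℝ} (hC : ∀ x, |f x| ≤ C)
    (hvar : autocov κ π (fun y => f y - ∫ z, f z ∂π) 0 ≠ 0)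
    (μ₀ : Measure Ω) [IsProbabilityMeasure μ₀] {a b : ℕ → ℕ} (ha : Tendsto a atTop atTop)
    (hb : Tendsto b atTop atTop) :
    TendstoInMeasure (Kernel.trajMeasure (X := fun _ : ℕ => Ω) μ₀
        (fun n : ℕ => κ.comap (fun h : (i : ↥(Finset.Iic n)) → Ω => h ⟨n, Finset.mem_Iic.2 le_rfl⟩)
          (measurable_pi_apply _)))
      (fun (n : ℕ) (x : ℕ → Ω) =>
        (((b n * a n : ℕ) : ℝ)
          * replicaSEsq (fun j (x : ℕ → Ω) => (∑ i ∈ Finset.range (b n), f (x (b n * j + i))) / (b n))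
            (a n) x)
        / (2 * ((∑ t ∈ Finset.range (b n * a n), f (x t) ^ 2) / ((b n * a n : ℕ) : ℝ)
            - ((∑ t ∈ Finset.range (b n * a n), f (x t)) / ((b n * a n : ℕ) : ℝ)) ^ 2)))
      atTop (fun _ => tauInt (fun t => autocov κ π (fun y => f y - ∫ z, f z ∂π) t
        / autocov κ π (fun y => f y - ∫ z, f z ∂π) 0)) := by
  set P := Kernel.trajMeasure (X := fun _ : ℕ => Ω) μ₀
      (fun n : ℕ => κ.comap (fun h : (i : ↥(Finset.Iic n)) → Ω => h ⟨n, Finset.mem_Iic.2 le_rfl⟩)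
        (measurable_pi_apply _)) with hP
  set γ : ℕ → ℝ := fun t => autocov κ π (fun y => f y - ∫ z, f z ∂π) t with hγ
  -- the target: `σ²_f / (2 γ₀) = tauInt (γ/γ₀)`
  have h2γ : 2 * γ 0 ≠ 0 := mul_ne_zero two_ne_zero hvar
  have hσ2 : (∫ y, (f y - ∫ z, f z ∂π) ^ 2 ∂π)
      + 2 * ∑' k, ∫ y, (f y - ∫ z, f z ∂π) * (kop κ)^[k + 1] (fun y => f y - ∫ z, f z ∂π) y ∂π
      = 2 * γ 0 * tauInt (fun t => γ t / γ 0) := by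
    rw [two_mul_mul_tauInt_eq hvar, autocov_zero]
    rfl
  have htarget : tauInt (fun t => γ t / γ 0)
      = ((∫ y, (f y - ∫ z, f z ∂π) ^ 2 ∂π)
        + 2 * ∑' k, ∫ y, (f y - ∫ z, f z ∂π) * (kop κ)^[k + 1] (fun y => f y - ∫ z, f z ∂π) y ∂π)
        / (2 * γ 0) := by
    rw [hσ2, mul_div_cancel_left₀ _ h2γ]
  -- numerator: batch means → σ²_f in measure
  have hnum := chain_batchMeans_sigmaHat_tendstoInMeasure (κ := κ) (ν := ν) hπ hmin hε0 hε hf hC μ₀ ha hb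
  rw [← hP] at hnum
  -- denominator: `2 v̂_{N_n} → 2 γ₀` a.s., hence in measure
  have hN : Tendsto (fun n => b n * a n) atTop atTop := hb.atTop_mul_atTop₀ ha
  have hγ0 : γ 0 = ∫ z, (f z - ∫ z', f z' ∂π) ^ 2 ∂π :=
    autocov_zero κ π (fun y => f y - ∫ z, f z ∂π)
  have hden_ae : ∀ᵐ x ∂P, Tendsto (fun n : ℕ =>
      2 * ((∑ t ∈ Finset.range (b n * a n), f (x t) ^ 2) / ((b n * a n : ℕ) : ℝ)
        - ((∑ t ∈ Finset.range (b n * a n), f (x t)) / ((b n * a n : ℕ) : ℝ)) ^ 2)) atTop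
      (𝓝 (2 * γ 0)) := by
    have h := chain_sampleVariance_ae_tendsto (κ := κ) (ν := ν) hπ hmin hε0 hε hf hC μ₀
    rw [← hP] at h
    filter_upwards [h] with x hx
    rw [hγ0]
    exact (hx.comp hN).const_mul 2
  have hdm : ∀ n, Measurable fun x : ℕ → Ω =>
      2 * ((∑ t ∈ Finset.range (b n * a n), f (x t) ^ 2) / ((b n * a n : ℕ) : ℝ)
        - ((∑ t ∈ Finset.range (b n * a n), f (x t)) / ((b n * a n : ℕ) : ℝ)) ^ 2) := fun n =>
    measurable_const.mul (((Finset.measurable_sum _ fun t _ =>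
      (hf.comp (measurable_pi_apply t)).pow_const 2).div_const _).sub
      (((Finset.measurable_sum _ fun t _ => hf.comp (measurable_pi_apply t)).div_const _).pow_const 2))
  have hden : TendstoInMeasure P (fun (n : ℕ) (x : ℕ → Ω) =>
      2 * ((∑ t ∈ Finset.range (b n * a n), f (x t) ^ 2) / ((b n * a n : ℕ) : ℝ)
        - ((∑ t ∈ Finset.range (b n * a n), f (x t)) / ((b n * a n : ℕ) : ℝ)) ^ 2)) atTop
      (fun _ => 2 * γ 0) :=
    tendstoInMeasure_of_tendsto_ae (fun n => (hdm n).aestronglyMeasurable) hden_ae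
  have hratio := tendstoInMeasure_div_const_limits
    (fun n => (measurable_batchMeans_sigmaHat hf (a n) (b n)).aestronglyMeasurable)
    (fun n => (hdm n).aestronglyMeasurable) hnum hden h2γ
  rw [htarget]
  exact hratio

end TauInt

end Summit.Ventures.LatticeQCDFlow.Scoring

end
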